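import Summits.NavierStokesRegularity.NavierStokesRegularity.Theorems.QuietScarPocketDoorDefs
import Summits.NavierStokesRegularity.NavierStokesRegularity.Theorems.ScalingDefectPeepholeDoorAnnularPressure
import Literature.Analysis.FluidPDE.DirectionDissipation

/-!
# QuietScarPocketDoorFrame — door S31 «QuietScarPocketDoor» (nsreg-p1 g25 ROUND-29 v2.1, texts `r29/Sketch31.lean` 363b5766493b6c28,
# sealed ref3 g24 5a5a841e25b902a3; Defs = `Theorems/QuietScarPocketDoorDefs.lean`), plate PT: THE FRAME TRANSFER

`frameTransferS31_holds : FrameTransferS31` (= `PVScarPocketRegularity → TargetScarPocket`): the parabolic change of variables of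
door S29 FILE 4b / door S30 plate P4 — `t = T + βs`, `x = x₀ + λz`, `λ² = νβ`, `v = (λ/ν) u(T+β·, x₀+λ·)`, point-gauged pressure
`q = (λ/ν)²(p − p(·,x₁))(T+β·, x₀+λ·)` (tree `pvFrame_isClassical`, `pv_typeI_transfer`, `isBackwardBoundedAt_of_pv_bound`,
ns-s29-p2's POINTWISE annular bound `annularPressureBoundS30_holds`), plus the one new line: the pocket datum is scale-covariant —
`curl v(s)(z) = (λ²/ν) curl u(t)(x)` (tree `curl_smul_stPull`), the pocket centre `z₁ = (x₁ − x₀)/λ`, so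
`‖z₁‖² ‖curl v(s)(z)‖ = ‖x₁ − x₀‖² ‖curl u(t)(x)‖/ν`, and `t ↑ T ⇔ s ↑ 0` along `s ↦ T + βs`.  Physical pocket threshold
`r₁ = λ r₁^{PV}(C_p)`.

Door S31 is a regularity CRITERION about the terminal vorticity trace of a HYPOTHETICAL one-point Type-I blow-up; item 0056 `NoTypeII`
and NS regularity are NOT proved and stay OPEN.
-/

noncomputable section

set_option linter.dupNamespace false

namespace Summit.NavierStokesRegularity.NavierStokesRegularity.Theorems.QuietScarPocketDoor

open MeasureTheory Set Function Filter Topology TopologicalSpace Metric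
open scoped Topology
open Literature.Analysis Literature.Analysis.FluidPDE
open Summit.NavierStokesRegularity.NavierStokesRegularity.Theorems.ScalingDefectPeepholeDoor
  (AnnularPressureBoundS30 annularPressureBoundS30_holds)
open Summit.NavierStokesRegularity.NavierStokesRegularity.Theorems.PeepholeVorticityDoor
  (pvFrame_isClassical pv_typeI_transfer isBackwardBoundedAt_of_pv_bound)

/-- the time change `s ↦ T + βs` (`β > 0`) maps `s ↑ 0` to `t ↑ T`. -/
theorem tendsto_time_affine_nhdsLT {T β : ℝ} (hβ : 0 < β) :
    Tendsto (fun s : ℝ => T + β * s) (𝓝[<] (0 : ℝ)) (𝓝[<] T) := by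
  refine tendsto_nhdsWithin_of_tendsto_nhds_of_eventually_within _ ?_ ?_
  · have hc : Continuous fun s : ℝ => T + β * s := continuous_const.add (continuous_const.mul continuous_id)
    simpa using hc.tendsto (0 : ℝ) |>.mono_left nhdsWithin_le_nhds
  · filter_upwards [self_mem_nhdsWithin] with s hs
    have hs' : s < 0 := hs
    show T + β * s < T
    nlinarith

/-- **PT reduction: `AnnularPressureBoundS30 → FrameTransferS31`.**  `C_u = |M|/ν + 1`; the PV-frame door's `ε` serves as the
physical `ε` (the pocket datum `‖x₁−x₀‖²‖ω‖/ν` is dimensionless); class pressure level `C_p` and scale `β` from the text; physical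
pocket threshold `r₁ = λ · r₁^{PV}(C_p)`, `λ = √(νβ)`. -/
theorem frameTransferS31_of_annularPressure (hP : AnnularPressureBoundS30) : FrameTransferS31 := by
  intro h ν hν M κ hκ hκ1
  set Cu : ℝ := |M| / ν + 1 with hCu_def
  have hCu : 0 < Cu := by positivity
  have hMCu : M / ν ≤ Cu := by
    have h1 : M / ν ≤ |M| / ν := div_le_div_of_nonneg_right (le_abs_self M) hν.le
    linarith
  obtain ⟨ε, hε, Hd⟩ := h Cu hCu κ hκ hκ1
  refine ⟨ε, hε, fun T ρ E₀ hT hρ => ?_⟩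
  obtain ⟨Cp, hCp, β, hβ, hβT, hβρ, hlamρ, HP⟩ := hP ν hν M T ρ E₀ hT hρ
  set lam : ℝ := Real.sqrt (ν * β) with hlam_def
  have hlam : 0 < lam := Real.sqrt_pos.2 (by positivity)
  have hlam2 : lam ^ 2 = ν * β := Real.sq_sqrt (by positivity)
  obtain ⟨r₁, hr₁, Hs⟩ := Hd Cp hCp
  refine ⟨lam * r₁, by positivity, ?_⟩
  intro u p hsol hLH hdec hE x₀ hM hpocket
  obtain ⟨x₁, hx₁0, hx₁r, hquiet⟩ := hpocket
  obtain ⟨xg, hxg⟩ := HP u p hsol hLH hdec hE x₀ hM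
  set v : ℝ → EuclideanSpace ℝ (Fin 3) → EuclideanSpace ℝ (Fin 3) := (lam / ν) • stPull β lam T x₀ u with hv_def
  set q : ℝ → EuclideanSpace ℝ (Fin 3) → ℝ :=
    (lam / ν) ^ 2 • stPull β lam T x₀ (fun t x => p t x - p t xg) with hq_def
  have hreg : IsClassicalNSSolutionOnRegion
      (Ico (-1 : ℝ) 0 ×ˢ ball (0 : EuclideanSpace ℝ (Fin 3)) 1) 1 0 v q :=
    pvFrame_isClassical hν hsol hβ hβT x₀ xg
  have hI : ∀ s ∈ Ico (-1 : ℝ) 0, ∀ z ∈ ball (0 : EuclideanSpace ℝ (Fin 3)) 1,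
      ‖v s z‖ ≤ Cu / (Real.sqrt (-s) + ‖z‖) :=
    pv_typeI_transfer hν hβT hβρ hlam hlam2 hlamρ hMCu hM
  have hPq : ∀ s ∈ Ico (-1 : ℝ) 0, ∀ z : EuclideanSpace ℝ (Fin 3), 1 / 2 < ‖z‖ → ‖z‖ < 3 / 4 → |q s z| ≤ Cp := hxg
  -- the pocket in the Pineau–Vicol frame
  set z₁ : EuclideanSpace ℝ (Fin 3) := lam⁻¹ • (x₁ - x₀) with hz₁_def
  have hz₁n : ‖z₁‖ = lam⁻¹ * ‖x₁ - x₀‖ := by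
    rw [hz₁_def, norm_smul, Real.norm_of_nonneg (inv_nonneg.2 hlam.le)]
  have hz₁0 : 0 < ‖z₁‖ := by rw [hz₁n]; positivity
  have hz₁r : ‖z₁‖ ≤ r₁ := by
    rw [hz₁n, inv_mul_le_iff₀ hlam]; exact hx₁r
  have hpocket' : ∃ z₁' : EuclideanSpace ℝ (Fin 3), 0 < ‖z₁'‖ ∧ ‖z₁'‖ ≤ r₁ ∧
      ∀ z ∈ ball z₁' (κ * ‖z₁'‖), ∀ᶠ s in 𝓝[<] (0 : ℝ), ‖z₁'‖ ^ 2 * ‖curl (v s) z‖ ≤ ε := by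
    refine ⟨z₁, hz₁0, hz₁r, fun z hz => ?_⟩
    -- the physical point `x = x₀ + λ z` lies in the physical pocket
    set x : EuclideanSpace ℝ (Fin 3) := x₀ + lam • z with hx_def
    have hx : x ∈ ball x₁ (κ * ‖x₁ - x₀‖) := by
      rw [mem_ball, dist_eq_norm] at hz ⊢
      have e : x - x₁ = lam • (z - z₁) := by
        rw [hx_def, hz₁_def, smul_sub, smul_smul, mul_inv_cancel₀ hlam.ne', one_smul]; abel
      rw [e, norm_smul, Real.norm_of_nonneg hlam.le]
      calc lam * ‖z - z₁‖ < lam * (κ * ‖z₁‖) := mul_lt_mul_of_pos_left hz hlam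
        _ = κ * ‖x₁ - x₀‖ := by rw [hz₁n]; field_simp
    have hq' := (tendsto_time_affine_nhdsLT (T := T) hβ).eventually (hquiet x hx)
    filter_upwards [hq'] with s hs
    -- covariance of the datum
    have hcurl : curl (v s) z = (lam / ν * lam) • curl (u (T + β * s)) (x₀ + lam • z) := by
      rw [hv_def]; exact curl_smul_stPull _ _ _ _ _ _ _ _
    have hcoef : lam / ν * lam = lam ^ 2 / ν := by ring
    rw [hcurl, hcoef, norm_smul (lam ^ 2 / ν) (curl (u (T + β * s)) (x₀ + lam • z)),
      Real.norm_of_nonneg (by positivity : (0 : ℝ) ≤ lam ^ 2 / ν), hz₁n]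
    rw [hx_def] at hs
    have hlamne : lam ≠ 0 := hlam.ne'
    calc (lam⁻¹ * ‖x₁ - x₀‖) ^ 2 * (lam ^ 2 / ν * ‖curl (u (T + β * s)) (x₀ + lam • z)‖)
        = ν⁻¹ * (‖x₁ - x₀‖ ^ 2 * ‖curl (u (T + β * s)) (x₀ + lam • z)‖) := by field_simp
      _ ≤ ν⁻¹ * (ν * ε) := mul_le_mul_of_nonneg_left hs (inv_nonneg.2 hν.le)
      _ = ε := by field_simp
  obtain ⟨ϱ, hϱ, B, hB⟩ := Hs v q hreg hI hPq hpocket'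
  exact isBackwardBoundedAt_of_pv_bound hν hβ hlam hϱ hB

/-- **Plate PT complete: the frame transfer `FrameTransferS31`** (through ns-s29-p2's pointwise annular pressure bound). -/
theorem frameTransferS31_holds : FrameTransferS31 :=
  frameTransferS31_of_annularPressure annularPressureBoundS30_holds

end Summit.NavierStokesRegularity.NavierStokesRegularity.Theorems.QuietScarPocketDoor

end
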